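import Summits.QuantumFields.YangMills.Theorems.FluctuationComparisonRegPrIntLS2BetaPosCollarCoverOfTubeChart
import Summits.QuantumFields.YangMills.Theorems.FluctuationComparisonRegPrIntLS2BetaGrowthOfHessianPos
import Summits.QuantumFields.YangMills.Theorems.FluctuationComparisonRegPrIntLS2BetaPivotResolveSmooth
import Summits.QuantumFields.YangMills.Theorems.UnitScaleTiltProp7CritEL
import HarnessLib

/-!
# S2β · POS∘ — THE TAYLOR HALF (T2c): TUBE♭ ⟸ {HESS∘, ISOL∘(δ)} — the Hessian edition of px8's door, along the re-solved transversal `y ↦ Φ (σ y)`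

Cell `ym3-torus` (YM ladder rung R3 = continuum `SU(2)` Yang–Mills on the three-torus at fixed lattice data — a RUNG: NOT d = 4, NOT infinite volume,
NOT a mass gap, NOT Clay).  Width seat `ym3-torus-px21` (gen 18); pen named by px8 g18 («the Taylor half: Hess > 0 on the tube frame at `y = 0` ⟹ POS∘ collar»).
(T1) ✓`…S2BetaGrowthOfHessianPos` (p793318), (T2a) `…S2BetaPosCollarOfGrowthRow`, (T2b) `…S2BetaPosCollarCoverOfTubeChart`.  Crux `stmt-QuantumFields-20520`
(`…Theses.UnitScaleTilt.FluctuationComparisonRegPrIntL`), LINE g18-1 S2β; `--kind proof --supports stmt-QuantumFields-20520 --as helper`, count-neutral, DEFINITION-FREE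
(0 `def`, 0 `instance`, 0 `notation`, 0 `sorry`, default heartbeats).

WHAT.  The composition (T1) ∘ (T2a) ∘ (T2b) ∘ ✓px8 `tubeGrowth_of_pos_of_isolated`, with HESS∘ displayed in print's form — POSITIVITY OF THE HESSIAN of the action along the
re-solved transversal at the base point, `∀ y ≠ 0, 0 < D²(A ∘ Φ_V ∘ σ)(0) y y` ([Balaban1985Variational] (142) p.299 «the second order differential … is a positive definite form»,
read modulo the residual gauge through the tubular transversal `σ` and inside the fibre through the re-solved pivots `Φ_V`):
* §0 `nhds_le_map_tubeChart` — the surjectivity row `𝓝 U₀ ≤ map Θ (𝓝 0)` from the tube chart's (F3) openness row + `0 ∈ UZ`, `0 ∈ UV`, `e 0 = 1`, `σ 0 = U₀`;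
* §1 `isLocalMin_transversal` — `0` is a local minimum of `y ↦ A (Φ_V (σ y))` once `Φ_V (σ 0) = U₀` is print's regular minimiser (`A U₀ = minActionRegPr`) and the transversal stays in
  print's regular fibre near `0` (✓`minActionRegPr_le`); `eventually_mem_regFibrePr_transversal` — it does, by ✓`Prop7CritEL.isOpen_regPr` + continuity + the descent clause;
* §2 ★★★ `growthRow_transversal_of_hessian_pos` — THE GROWTH ROW with `m := minActionRegPr` from HESS∘ + `C²` of the matrix field (✓`contDiffAt_wilsonAction4_of_coeField`) + §1, by (T1);
* §3 ★★★ `posCollar_of_hessian_pos` — px8's POS∘ letter VERBATIM ⟸ HESS∘ (+ the (T2b) chart∕tube∕local rows); ★★★★ `tubeGrowth_of_hessian_pos_of_isolated` — TUBE♭(V, U₀) ⟸ {HESS∘, ISOL∘(δ)}.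

DISPLAYED (hypotheses, by name, with their tree suppliers): a fibred chart `Φ` at `V` with the CLOSURE-FORM RECOGNITION row (w3-20520 g14's chart of record
✓`…ChartContLaplaceRows.exists_laplaceRows` :154, `Φ := c.Φ (V, ·)`); `hcont` «`descendTo` continuous near `U₀`» ((T2d) ✓∕⧗`…S2BetaPosCollarLocalRows`); tube chart `(e, σ)` with
surjectivity `𝓝 U₀ ≤ map Θ (𝓝 0)` (✓`exists_tubularHaarChart_pivotAct_local`); `hΦ0 : Φ (σ 0) = U₀` (self-recognition :144 + `σ 0 = U₀`); `hΦs : ContDiffAt ℝ 2 (coeField ∘ Φ ∘ σ) 0`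
(✓`contDiffAt_coeField_resolve`); `hmin`, `hU₀reg` (EXW∘: `U₀` is print's regular minimiser, `A U₀ = minActionRegPr`, `U₀ ∈ regFibrePr`), `hfib` (chart clause: `Φ (σ y)` descends to `V` near `0`); HESS∘; ISOL∘(δ).
HONEST: composition over landed letters; HESS∘ (print's (142); uniformly: [Balaban1985BackgroundPropagators] Thm 3.11) and ISOL∘(δ) (the small-field contraction) are NOT proved; TUBE-REG∘,
GAP♯∘, GAP♭, EXW∘, S2β, crux 20520 NOT proved; no summit statement is proved by a helper; finite-volume ∕ conditional; rung R3 = SU(2) YM₃ on T³ — NOT d = 4, NOT infinite volume,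
NOT a mass gap, NOT Clay; the Yang–Mills mass gap is NOT proved.  Sorry-free, axioms standard.

References: T. Bałaban, CMP **102** (1985) 277–309 [Balaban1985Variational] (Thm 1 (8)–(10) p.279, (142) p.299); CMP **102** (1985) 255–275 [Balaban1985UV3] ((12)–(13) p.259,
(18)–(22) p.260); K. W. Breitung, LNM 1592 (1994) [Breitung1994] (Thm 41 p.56).
-/

set_option autoImplicit false

noncomputable section

namespace Summit.QuantumFields.YangMills.Theorems.FluctuationComparisonRegPrIntLS2BetaTubeGrowthOfHessianPos

open Set Filter Topology Function
open scoped Matrix.Norms.L2Operator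
open Literature.MathematicalPhysics.QuantumFieldTheory.Balaban1983to89
open Literature.MathematicalPhysics.QuantumFieldTheory.Balaban1983to89.T3ContinuumYM3Torus
open Literature.MathematicalPhysics.QuantumFieldTheory.Balaban1983to89.T3UnitLawDensityEML (ℰp)
open Literature.MathematicalPhysics.QuantumFieldTheory.Balaban1983to89.T3UnitScaleTilt
open Literature.MathematicalPhysics.QuantumFieldTheory.Balaban1983to89.T3TiltDescent
open Literature.MathematicalPhysics.QuantumFieldTheory.Balaban1983to89.T3ConstrainedMinimiser (fibre)
open Literature.MathematicalPhysics.QuantumFieldTheory.Balaban1983to89.T3PrintedRegularMinimiser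
open Literature.MathematicalPhysics.QuantumFieldTheory.Balaban1983to89.T4Continuum
open scoped Literature.MathematicalPhysics.QuantumFieldTheory.Balaban1983to89.T3OrbitAverage
open Literature.MathematicalPhysics.QuantumFieldTheory.Balaban1983to89.Node00 (coeField)
open Summit.QuantumFields.YangMills.Theorems.FluctuationComparisonRegPrIntLWregChain (iterCentralBond)
open Summit.QuantumFields.YangMills.Theorems.FluctuationComparisonRegPrIntLS2BetaResidualSubgroup
open Summit.QuantumFields.YangMills.Theorems.FluctuationComparisonRegPrIntLS2BetaGrowthOfHessianPos (growthRow_of_hessian_pos)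
open Summit.QuantumFields.YangMills.Theorems.FluctuationComparisonRegPrIntLS2BetaPosCollarCoverOfTubeChart
open Summit.QuantumFields.YangMills.Theorems.FluctuationComparisonRegPrIntLS2BetaPivotResolveSmooth (contDiffAt_wilsonAction4_of_coeField)
open Summit.QuantumFields.YangMills.Theorems.Prop7CritEL (isOpen_regPr)

variable (F : T3Family) {J K : ℕ} (hJK : J ≤ K)

/-! ## §0 The surjectivity row from the tube chart's openness-at-every-point row (F3) -/

section Surj

/-- The SURJECTIVITY row `𝓝 U₀ ≤ map Θ (𝓝 0)` of the (T2b) cover from the rows of ✓`exists_tubeRows` ∕ ✓`exists_tubularHaarChart_pivotAct_local`: openness of the tube map at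
every point of the window ((F3)), `0 ∈ UZ`, `0 ∈ UV`, `e 0 = 1`, `σ 0 = U₀` (`Θ (0,0) = pivotAct 1 U₀ = U₀`, ✓`pivotAct_one`; `Filter.le_map`).
[cite: Helgason2000, Ch. I §1 Thm 1.14 p.96; Balaban1985Averaging, (8) p.19] -/
theorem nhds_le_map_tubeChart {U₀ : GaugeField (F.P K) 0 (Matrix.specialUnitaryGroup (Fin 2) ℂ)}
    {Z Y : Type*} [TopologicalSpace Z] [Zero Z] [TopologicalSpace Y] [Zero Y]
    (e : Z → ↥(residualSubgroup F hJK) × (PBond (F.P K) (K - J) → Matrix.specialUnitaryGroup (Fin 2) ℂ))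
    (σ : Y → GaugeField (F.P K) 0 (Matrix.specialUnitaryGroup (Fin 2) ℂ)) (he0 : e 0 = 1) (hσ0 : σ 0 = U₀)
    {UZ : Set Z} {UV : Set Y} (h0Z : (0 : Z) ∈ UZ) (h0V : (0 : Y) ∈ UV)
    (hF3 : ∀ p ∈ UZ ×ˢ UV, ∀ s ∈ 𝓝 p, (fun p : Z × Y => pivotAct F hJK (iterCentralBond (P := F.P K) (K - J)) (e p.1) (σ p.2)) '' s ∈
      𝓝 ((fun p : Z × Y => pivotAct F hJK (iterCentralBond (P := F.P K) (K - J)) (e p.1) (σ p.2)) p)) :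
    𝓝 U₀ ≤ map (fun p : Z × Y => pivotAct F hJK (iterCentralBond (P := F.P K) (K - J)) (e p.1) (σ p.2)) (𝓝 0) := by
  have h00 : (fun p : Z × Y => pivotAct F hJK (iterCentralBond (P := F.P K) (K - J)) (e p.1) (σ p.2)) (0 : Z × Y) = U₀ := by
    show pivotAct F hJK (iterCentralBond (P := F.P K) (K - J)) (e 0) (σ 0) = U₀
    rw [he0, hσ0, pivotAct_one]
  refine Filter.le_map fun s hs => ?_
  have h := hF3 (0 : Z × Y) ⟨h0Z, h0V⟩ s hs
  rwa [h00] at h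

end Surj

/-! ## §1 The base point minimises the action along a regular transversal -/

section LocalMin

variable {Y : Type*} [TopologicalSpace Y] [Zero Y] {ε₀ : ℝ}

/-- `0` is a local minimum of `y ↦ A (Ψ y)` when `Ψ 0 = U₀` realises print's regular minimum (`A U₀ = minActionRegPr`) and `Ψ y` stays in print's regular fibre for `y` near `0`
(✓`minActionRegPr_le`). [cite: Balaban1985Variational, Thm 1 (8) p.279] -/
theorem isLocalMin_transversal (V : GaugeField (F.P J) 0 (Matrix.specialUnitaryGroup (Fin 2) ℂ)) (U₀ : GaugeField (F.P K) 0 (Matrix.specialUnitaryGroup (Fin 2) ℂ))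
    (Ψ : Y → GaugeField (F.P K) 0 (Matrix.specialUnitaryGroup (Fin 2) ℂ)) (hΨ0 : Ψ 0 = U₀)
    (hmin : wilsonAction4 U₀ = minActionRegPr F J K hJK ε₀ V) (hreg : ∀ᶠ y in 𝓝 (0 : Y), Ψ y ∈ regFibrePr F J K hJK ε₀ V) :
    IsLocalMin (fun y => wilsonAction4 (Ψ y)) 0 := by
  filter_upwards [hreg] with y hy
  show wilsonAction4 (Ψ 0) ≤ wilsonAction4 (Ψ y)
  rw [hΨ0, hmin]
  exact minActionRegPr_le F hy

/-- The re-solved transversal stays in print's regular fibre near `0`: `Ψ 0 = U₀ ∈ regFibrePr` (EXW∘), `Ψ` continuous at `0`, and `Ψ y` descends to `V` for `y` near `0` (chart clause) —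
print's regular class `𝔘_k(ε₀)` is open (✓`Prop7CritEL.isOpen_regPr`). [cite: Balaban1985Variational, (2), (6) p.278] -/
theorem eventually_mem_regFibrePr_transversal (V : GaugeField (F.P J) 0 (Matrix.specialUnitaryGroup (Fin 2) ℂ)) (U₀ : GaugeField (F.P K) 0 (Matrix.specialUnitaryGroup (Fin 2) ℂ))
    (Ψ : Y → GaugeField (F.P K) 0 (Matrix.specialUnitaryGroup (Fin 2) ℂ)) (hΨ0 : Ψ 0 = U₀) (hΨc : ContinuousAt Ψ 0)
    (hU₀reg : U₀ ∈ regFibrePr F J K hJK ε₀ V) (hfib : ∀ᶠ y in 𝓝 (0 : Y), descendTo F ℰp J K hJK (Ψ y) = V) :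
    ∀ᶠ y in 𝓝 (0 : Y), Ψ y ∈ regFibrePr F J K hJK ε₀ V := by
  have hreg0 : Ψ 0 ∈ {U : GaugeField (F.P K) 0 (Matrix.specialUnitaryGroup (Fin 2) ℂ) | RegPr F J K ε₀ U} := by
    rw [hΨ0]; exact ((mem_regFibrePr_iff F).1 hU₀reg).2
  have hev : ∀ᶠ y in 𝓝 (0 : Y), RegPr F J K ε₀ (Ψ y) := hΨc.preimage_mem_nhds ((isOpen_regPr F J K ε₀).mem_nhds hreg0)
  filter_upwards [hev, hfib] with y hy hyf
  exact (mem_regFibrePr_iff F).2 ⟨hyf, hy⟩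

end LocalMin

section Continuity

variable {Y : Type*} [NormedAddCommGroup Y] [NormedSpace ℝ Y]

/-- A transversal whose matrix field is differentiable at `0` is continuous at `0` (bondwise, `SU(2) ≤ M₂(ℂ)` carries the induced topology). [folklore] -/
theorem continuousAt_of_differentiableAt_coeField (Ψ : Y → GaugeField (F.P K) 0 (Matrix.specialUnitaryGroup (Fin 2) ℂ))
    (hΨ : DifferentiableAt ℝ (fun y => coeField (Ψ y)) 0) : ContinuousAt Ψ 0 := by
  refine continuousAt_pi.2 fun b => ?_
  have h : ContinuousAt (fun y => ((Ψ y b : Matrix.specialUnitaryGroup (Fin 2) ℂ) : Matrix (Fin 2) (Fin 2) ℂ)) 0 :=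
    ((continuous_apply b).continuousAt.comp hΨ.continuousAt)
  exact (Topology.IsInducing.subtypeVal.continuousAt_iff).2 h

end Continuity

/-! ## §2 The growth row (with `m := minActionRegPr`) from HESS∘ -/

section Growth

variable {Y : Type*} [NormedAddCommGroup Y] [InnerProductSpace ℝ Y] [FiniteDimensional ℝ Y] {ε₀ : ℝ}

/-- ★★★ **THE GROWTH ROW FROM HESS∘ ALONG A REGULAR TRANSVERSAL THROUGH PRINT'S MINIMISER**: `Ψ 0 = U₀`, `A U₀ = minActionRegPr`, `Ψ` regular near `0`, the matrix field
`y ↦ ↑(Ψ y)` `C²` at `0`, and HESS∘ `∀ y ≠ 0, 0 < D²(A ∘ Ψ)(0) y y` ⟹ `∃ c₁ > 0, ∀ᶠ y in 𝓝 0, c₁‖y‖² ≤ A (Ψ y) − minActionRegPr` ((T1) ✓`growthRow_of_hessian_pos`).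
[cite: Balaban1985Variational, (142) p.299; Breitung1994, Thm 41 p.56] -/
theorem growthRow_transversal_of_hessian_pos (V : GaugeField (F.P J) 0 (Matrix.specialUnitaryGroup (Fin 2) ℂ))
    (U₀ : GaugeField (F.P K) 0 (Matrix.specialUnitaryGroup (Fin 2) ℂ))
    (Ψ : Y → GaugeField (F.P K) 0 (Matrix.specialUnitaryGroup (Fin 2) ℂ)) (hΨ0 : Ψ 0 = U₀)
    (hmin : wilsonAction4 U₀ = minActionRegPr F J K hJK ε₀ V) (hreg : ∀ᶠ y in 𝓝 (0 : Y), Ψ y ∈ regFibrePr F J K hJK ε₀ V)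
    (hΨs : ContDiffAt ℝ 2 (fun y => coeField (Ψ y)) 0)
    (hH : ∀ y, y ≠ 0 → 0 < fderiv ℝ (fderiv ℝ (fun y => wilsonAction4 (Ψ y))) 0 y y) :
    ∃ c₁ : ℝ, 0 < c₁ ∧ ∀ᶠ y in 𝓝 (0 : Y), c₁ * ‖y‖ ^ 2 ≤ wilsonAction4 (Ψ y) - minActionRegPr F J K hJK ε₀ V := by
  have hφ : ContDiffAt ℝ 2 (fun y => wilsonAction4 (Ψ y)) 0 := contDiffAt_wilsonAction4_of_coeField hΨs
  obtain ⟨c, hc, hgrow⟩ := growthRow_of_hessian_pos hφ (isLocalMin_transversal F hJK V U₀ Ψ hΨ0 hmin hreg) hH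
  refine ⟨c, hc, ?_⟩
  have h0 : wilsonAction4 (Ψ 0) = minActionRegPr F J K hJK ε₀ V := by rw [hΨ0, hmin]
  simpa only [h0] using hgrow

end Growth

/-! ## §3 POS∘ and TUBE♭ from HESS∘ -/

section Assembly

variable {γ b₀ p₀ ε₀ : ℝ}

/-- ★★★ **POS∘ ⟸ HESS∘** (px8's `hpos` letter of ✓`tubeGrowth_of_pos_of_isolated`, VERBATIM), along the re-solved transversal `y ↦ Φ (σ y)` of the tube chart docked on a fibred chart with
closure-form recognition. [cite: Balaban1985Variational, (142) p.299; Balaban1985UV3, (18)-(22) p.260; Balaban1987RG1, (2.10) p.267] -/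
theorem posCollar_of_hessian_pos
    (V : GaugeField (F.P J) 0 (Matrix.specialUnitaryGroup (Fin 2) ℂ)) (U₀ : GaugeField (F.P K) 0 (Matrix.specialUnitaryGroup (Fin 2) ℂ)) (δ : ℝ)
    (Φ : GaugeField (F.P K) 0 (Matrix.specialUnitaryGroup (Fin 2) ℂ) → GaugeField (F.P K) 0 (Matrix.specialUnitaryGroup (Fin 2) ℂ))
    (hrecog : ∀ z U', U' ∈ closure (histGood F ℰp (θBal F.L γ b₀ p₀) K J) → descendTo F ℰp J K hJK U' = V →
      (∀ b : PBond (F.P K) 0, (∀ c, iterCentralBond (P := F.P K) (K - J) c ≠ b) → U' b = z b) → Φ z = U')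
    (hcont : ∀ᶠ W in 𝓝 U₀, ContinuousAt (descendTo F ℰp J K hJK) W)
    {Z : Type*} [TopologicalSpace Z] [Zero Z] {Y : Type*} [NormedAddCommGroup Y] [InnerProductSpace ℝ Y] [FiniteDimensional ℝ Y]
    (e : Z → ↥(residualSubgroup F hJK) × (PBond (F.P K) (K - J) → Matrix.specialUnitaryGroup (Fin 2) ℂ))
    (σ : Y → GaugeField (F.P K) 0 (Matrix.specialUnitaryGroup (Fin 2) ℂ))
    (hΘ : 𝓝 U₀ ≤ map (fun p : Z × Y => pivotAct F hJK (iterCentralBond (P := F.P K) (K - J)) (e p.1) (σ p.2)) (𝓝 0))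
    (hΦ0 : Φ (σ 0) = U₀) (hΦs : ContDiffAt ℝ 2 (fun y => coeField (Φ (σ y))) 0)
    (hmin : wilsonAction4 U₀ = minActionRegPr F J K hJK ε₀ V) (hU₀reg : U₀ ∈ regFibrePr F J K hJK ε₀ V)
    (hfib : ∀ᶠ y in 𝓝 (0 : Y), descendTo F ℰp J K hJK (Φ (σ y)) = V)
    (hH : ∀ y, y ≠ 0 → 0 < fderiv ℝ (fderiv ℝ (fun y => wilsonAction4 (Φ (σ y)))) 0 y y) :
    ∃ r c : ℝ, 0 < r ∧ 0 < c ∧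
      ∀ U ∈ closure (fibre F ℰp J K hJK V ∩ histGood F ℰp (θBal F.L γ b₀ p₀) K J),
        (∃ w : Site (F.P K) 0 → Matrix.specialUnitaryGroup (Fin 2) ℂ,
          (∀ U'' : GaugeField (F.P K) 0 (Matrix.specialUnitaryGroup (Fin 2) ℂ),
              descendTo F ℰp J K hJK (GaugeField.gaugeAct w U'') = descendTo F ℰp J K hJK U'') ∧
            ∀ ℓ : PBond (F.P K) 0, dist1 (U ℓ * ((GaugeField.gaugeAct w U₀) ℓ)⁻¹) ≤ δ) →
        (⨅ w : {w : Site (F.P K) 0 → Matrix.specialUnitaryGroup (Fin 2) ℂ |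
            ∀ U : GaugeField (F.P K) 0 (Matrix.specialUnitaryGroup (Fin 2) ℂ),
              descendTo F ℰp J K hJK (GaugeField.gaugeAct w U) = descendTo F ℰp J K hJK U},
          ∑ ℓ : PBond (F.P K) 0,
            dist1 (U ℓ * ((GaugeField.gaugeAct (w : Site (F.P K) 0 → Matrix.specialUnitaryGroup (Fin 2) ℂ) U₀) ℓ)⁻¹) ^ 2) ≤ r →
        c * (⨅ w : {w : Site (F.P K) 0 → Matrix.specialUnitaryGroup (Fin 2) ℂ |
            ∀ U : GaugeField (F.P K) 0 (Matrix.specialUnitaryGroup (Fin 2) ℂ),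
              descendTo F ℰp J K hJK (GaugeField.gaugeAct w U) = descendTo F ℰp J K hJK U},
          ∑ ℓ : PBond (F.P K) 0,
            dist1 (U ℓ * ((GaugeField.gaugeAct (w : Site (F.P K) 0 → Matrix.specialUnitaryGroup (Fin 2) ℂ) U₀) ℓ)⁻¹) ^ 2)
          ≤ wilsonAction4 U - minActionRegPr F J K hJK ε₀ V :=
  posCollar_of_growthRow_of_recog F hJK V U₀ δ Φ hrecog hcont e σ hΘ hΦ0 (hΦs.differentiableAt (by norm_num))
    (growthRow_transversal_of_hessian_pos F hJK V U₀ (fun y => Φ (σ y)) hΦ0 hmin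
      (eventually_mem_regFibrePr_transversal F hJK V U₀ (fun y => Φ (σ y)) hΦ0
        (continuousAt_of_differentiableAt_coeField F (fun y => Φ (σ y)) (hΦs.differentiableAt (by norm_num))) hU₀reg hfib) hΦs hH)

/-- ★★★★ **TUBE♭(V,U₀) ⟸ {HESS∘, ISOL∘(δ)}** — px8 g18's ✓`tubeGrowth_of_pos_of_isolated` with its POS∘ letter discharged from the HESSIAN along the re-solved transversal: at the datum,
`∃ μ > 0`, `μ·L^{−2(K−J)}·⨅_w Σ_ℓ dist1 (U ℓ·((w•U₀) ℓ)⁻¹)² ≤ A U − minActionRegPr` for every good history `U` of the fibre in the `δ`-tube about the residual orbit of `U₀` (the body of TUBE-REG∘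
with `∃ μ` after `U₀`).  The two displayed analytic inputs are exactly print's (142) (HESS∘) and its tube-wide consequence (ISOL∘(δ)).
[cite: Balaban1985Variational, (142) p.299; Balaban1985UV3, (12)-(13) p.259 and (18)-(22) p.260] -/
theorem tubeGrowth_of_hessian_pos_of_isolated
    (V : GaugeField (F.P J) 0 (Matrix.specialUnitaryGroup (Fin 2) ℂ)) (U₀ : GaugeField (F.P K) 0 (Matrix.specialUnitaryGroup (Fin 2) ℂ)) (δ : ℝ)
    (Φ : GaugeField (F.P K) 0 (Matrix.specialUnitaryGroup (Fin 2) ℂ) → GaugeField (F.P K) 0 (Matrix.specialUnitaryGroup (Fin 2) ℂ))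
    (hrecog : ∀ z U', U' ∈ closure (histGood F ℰp (θBal F.L γ b₀ p₀) K J) → descendTo F ℰp J K hJK U' = V →
      (∀ b : PBond (F.P K) 0, (∀ c, iterCentralBond (P := F.P K) (K - J) c ≠ b) → U' b = z b) → Φ z = U')
    (hcont : ∀ᶠ W in 𝓝 U₀, ContinuousAt (descendTo F ℰp J K hJK) W)
    {Z : Type*} [TopologicalSpace Z] [Zero Z] {Y : Type*} [NormedAddCommGroup Y] [InnerProductSpace ℝ Y] [FiniteDimensional ℝ Y]
    (e : Z → ↥(residualSubgroup F hJK) × (PBond (F.P K) (K - J) → Matrix.specialUnitaryGroup (Fin 2) ℂ))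
    (σ : Y → GaugeField (F.P K) 0 (Matrix.specialUnitaryGroup (Fin 2) ℂ))
    (hΘ : 𝓝 U₀ ≤ map (fun p : Z × Y => pivotAct F hJK (iterCentralBond (P := F.P K) (K - J)) (e p.1) (σ p.2)) (𝓝 0))
    (hΦ0 : Φ (σ 0) = U₀) (hΦs : ContDiffAt ℝ 2 (fun y => coeField (Φ (σ y))) 0)
    (hmin : wilsonAction4 U₀ = minActionRegPr F J K hJK ε₀ V) (hU₀reg : U₀ ∈ regFibrePr F J K hJK ε₀ V)
    (hfib : ∀ᶠ y in 𝓝 (0 : Y), descendTo F ℰp J K hJK (Φ (σ y)) = V)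
    (hH : ∀ y, y ≠ 0 → 0 < fderiv ℝ (fderiv ℝ (fun y => wilsonAction4 (Φ (σ y)))) 0 y y)
    (hisol : ∀ U ∈ closure (fibre F ℰp J K hJK V ∩ histGood F ℰp (θBal F.L γ b₀ p₀) K J),
        (∃ w : Site (F.P K) 0 → Matrix.specialUnitaryGroup (Fin 2) ℂ,
          (∀ U'' : GaugeField (F.P K) 0 (Matrix.specialUnitaryGroup (Fin 2) ℂ),
              descendTo F ℰp J K hJK (GaugeField.gaugeAct w U'') = descendTo F ℰp J K hJK U'') ∧
            ∀ ℓ : PBond (F.P K) 0, dist1 (U ℓ * ((GaugeField.gaugeAct w U₀) ℓ)⁻¹) ≤ δ) →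
        wilsonAction4 U ≤ minActionRegPr F J K hJK ε₀ V →
        (⨅ w : {w : Site (F.P K) 0 → Matrix.specialUnitaryGroup (Fin 2) ℂ |
            ∀ U : GaugeField (F.P K) 0 (Matrix.specialUnitaryGroup (Fin 2) ℂ),
              descendTo F ℰp J K hJK (GaugeField.gaugeAct w U) = descendTo F ℰp J K hJK U},
          ∑ ℓ : PBond (F.P K) 0,
            dist1 (U ℓ * ((GaugeField.gaugeAct (w : Site (F.P K) 0 → Matrix.specialUnitaryGroup (Fin 2) ℂ) U₀) ℓ)⁻¹) ^ 2) = 0) :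
    ∃ μ : ℝ, 0 < μ ∧ ∀ U ∈ fibre F ℰp J K hJK V, U ∈ histGood F ℰp (θBal F.L γ b₀ p₀) K J →
      (∃ w : Site (F.P K) 0 → Matrix.specialUnitaryGroup (Fin 2) ℂ,
        (∀ U'' : GaugeField (F.P K) 0 (Matrix.specialUnitaryGroup (Fin 2) ℂ),
            descendTo F ℰp J K hJK (GaugeField.gaugeAct w U'') = descendTo F ℰp J K hJK U'') ∧
          ∀ ℓ : PBond (F.P K) 0, dist1 (U ℓ * ((GaugeField.gaugeAct w U₀) ℓ)⁻¹) ≤ δ) →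
      μ * ((F.L : ℝ)⁻¹) ^ (2 * (K - J)) *
          (⨅ w : {w : Site (F.P K) 0 → Matrix.specialUnitaryGroup (Fin 2) ℂ |
              ∀ U : GaugeField (F.P K) 0 (Matrix.specialUnitaryGroup (Fin 2) ℂ),
                descendTo F ℰp J K hJK (GaugeField.gaugeAct w U) = descendTo F ℰp J K hJK U},
            ∑ ℓ : PBond (F.P K) 0,
              dist1 (U ℓ * ((GaugeField.gaugeAct (w : Site (F.P K) 0 → Matrix.specialUnitaryGroup (Fin 2) ℂ) U₀) ℓ)⁻¹) ^ 2)
        ≤ wilsonAction4 U - minActionRegPr F J K hJK ε₀ V :=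
  tubeGrowth_of_growthRow_of_isolated_of_recog F hJK V U₀ δ Φ hrecog hcont e σ hΘ hΦ0 (hΦs.differentiableAt (by norm_num))
    (growthRow_transversal_of_hessian_pos F hJK V U₀ (fun y => Φ (σ y)) hΦ0 hmin
      (eventually_mem_regFibrePr_transversal F hJK V U₀ (fun y => Φ (σ y)) hΦ0
        (continuousAt_of_differentiableAt_coeField F (fun y => Φ (σ y)) (hΦs.differentiableAt (by norm_num))) hU₀reg hfib) hΦs hH) hisol

end Assembly

end Summit.QuantumFields.YangMills.Theorems.FluctuationComparisonRegPrIntLS2BetaTubeGrowthOfHessianPos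

end
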